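import Mathlib
import Literature.AlgebraicGeometry.HyperbolicPolynomials.HyperbolicityCone
import Literature.AlgebraicGeometry.HyperbolicPolynomials.SmoothBoundary
import Literature.AlgebraicGeometry.HyperbolicPolynomials.CompressionDeterminant

/-!
# PermanentalConeHard (stmt-ValiantsHypothesis-8654) — gradients from a line product formula
(infrastructure for the no-go `stub_twoRowsNotWitness`, lead c3)

Route `PermanentalCones` of `ValiantsHypothesis`, crux `PermanentalConeHard`, line `registered`,
stub `stub_gradForm_of_line_prod`.  If a polynomial `f ∈ ℝ[s_1..s_N]` factors along the line
`u ↦ y + u v` as `f(y + u v) = c ∏_{j<n} (u + d_j)` for all real `u` (in the assembly `f = e_n` and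
the `d_j` are the eigenvalues of a compression matrix), then the directional derivative of `f` at
`y + τ v` in direction `v` has the closed form
`⟨∇f(y + τ v), v⟩ = gradForm f (y + τ • v) v = c · e_{n-1}(d_1 + τ, …, d_n + τ)`,
the coefficient of `u¹` in `c ∏_j (u + (d_j + τ))` (Vieta).

Proof: the shifted line polynomial `linePoly f (y + τ • v) v = (u ↦ f(y + (τ + u) v))` agrees
with `C c · ∏_j (X + C (d_j + τ))` at every real `u`, hence equals it (`Polynomial.funext`, `ℝ`
infinite); then `gradForm_apply` (`gradForm f x v = coeff₁ (linePoly f x v)`) and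
`coeff_prod_X_add_C_eq_esymm` (Vieta for `∏ (X + xᵢ)`).

References: J. Renegar, *Hyperbolic programs, and their derivative relaxations*, Found. Comput.
Math. 6 (2006) 59–79, §2 (the line polynomial `t ↦ p(x + te)` and its factorisation).  Proved in
full.
-/

set_option linter.dupNamespace false

noncomputable section

namespace Summit.ValiantsHypothesis.ValiantsHypothesis.Theorems.PermanentalConesPermanentalConeHard

open MvPolynomial Finset
open scoped BigOperators Polynomial
open Literature.AlgebraicGeometry.HyperbolicPolynomials

/-- Shifting the base point along the direction: `linePoly f (y + τ • v) v` evaluates at `u` to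
`f(y + (τ + u) v)`. [folklore] -/
theorem eval_linePoly_add_smul {N : ℕ} (f : MvPolynomial (Fin N) ℝ) (y v : Fin N → ℝ)
    (τ u : ℝ) : (linePoly f (y + τ • v) v).eval u = MvPolynomial.eval (y + (τ + u) • v) f := by
  rw [eval_linePoly, add_smul, add_assoc]

/-- A product formula along a line determines every shifted line polynomial: if
`f(y + u v) = c ∏_j (u + d_j)` for all real `u`, then
`linePoly f (y + τ • v) v = C c · ∏_j (X + C (d_j + τ))` (two real polynomials agreeing at every
point of the infinite field `ℝ` are equal). [cite: Renegar2006, §2] -/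
theorem linePoly_add_smul_eq_C_mul_prod {N n : ℕ} (f : MvPolynomial (Fin N) ℝ) (y v : Fin N → ℝ)
    (c : ℝ) (d : Fin n → ℝ) (h : ∀ u : ℝ, MvPolynomial.eval (y + u • v) f = c * ∏ j, (u + d j))
    (τ : ℝ) :
    linePoly f (y + τ • v) v = Polynomial.C c * ∏ j, (Polynomial.X + Polynomial.C (d j + τ)) := by
  refine Polynomial.funext fun u => ?_
  rw [eval_linePoly_add_smul, h (τ + u), Polynomial.eval_mul, Polynomial.eval_C,
    Polynomial.eval_prod]
  congr 1
  refine Finset.prod_congr rfl fun j _ => ?_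
  rw [Polynomial.eval_add, Polynomial.eval_X, Polynomial.eval_C]
  ring

/-- Registered form (`stub_gradForm_of_line_prod`, infrastructure stub of the no-go
`stub_twoRowsNotWitness`): from `f(y + u v) = c ∏_{j<n} (u + d_j)` for all real `u` (`n ≥ 1`),
the directional derivative along the line is `⟨∇f(y + τ v), v⟩ = c · e_{n-1}(d + τ𝟙)` (Vieta:
the coefficient of `u¹` in `c ∏_j (u + (d_j + τ))`). [folklore] -/
theorem stub_gradForm_of_line_prod : ∀ (N n : ℕ) (f : MvPolynomial (Fin N) ℝ) (y v : Fin N → ℝ) (c : ℝ) (d : Fin n → ℝ), 1 ≤ n → (∀ u : ℝ, MvPolynomial.eval (y + u • v) f = c * ∏ j, (u + d j)) → ∀ τ : ℝ, gradForm f (y + τ • v) v = c * MvPolynomial.eval (fun j => d j + τ) (MvPolynomial.esymm (Fin n) ℝ (n - 1)) := by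
  intro N n f y v c d hn h τ
  rw [gradForm_apply, linePoly_add_smul_eq_C_mul_prod f y v c d h τ, Polynomial.coeff_C_mul,
    coeff_prod_X_add_C_eq_esymm (fun j => d j + τ) hn]

end Summit.ValiantsHypothesis.ValiantsHypothesis.Theorems.PermanentalConesPermanentalConeHard

end
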